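import Summits.AtomisticToContinuum.Crystallization.Theorems.ChargedEnergyGap.Negative.BlocksBound
import Literature.MathematicalPhysics.StatisticalMechanics.CrystallizationSymmetries
import Literature.MathematicalPhysics.StatisticalMechanics.CrystallizationLocalLimit

/-!
# `ChargedPeriodicIsOptimal` (stmt-AtomisticToContinuum-2913), helpers II: blocks as patches

Lemmas about the finite blocks `bpt Q K : F × [0,K)³ → Q.points` of a periodic configuration
`Q = F + G` of `ℝ³` (tree `ChargedEnergyGap/Negative/Blocks*`), used as the excised patches in
the proof of item 2913 (`PricedLinkCensus.ChargedPeriodicIsOptimal`):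

* `lennardJones_le_six` — `V_LJ(r) ≤ (1/12) δ⁻⁶ r⁻⁶` for `r ≥ δ > 0`, whence the Lennard-Jones
  tail of a block point is at most `(1/12) δ_Q⁻⁶ ·` its sixth-power tail (`tail_le_tailSix`)
  and the LOWER block-energy bound `2E(block) ≥ K³·2#F·e(Q) − (1/12)δ_Q⁻⁶ Σ tailSix`
  (`two_mul_energy_block_ge`);
* `exists_block_radius` — all block points lie within some `R₀` of every motif point;
* `exists_energy_modulus_block` — continuity of the finite Lennard-Jones energy at the
  (injective) block configuration, as an `ε₀`–`η` modulus in the sup distance, and its transfer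
  to configurations near an ISOMETRIC IMAGE of the block (`abs_energy_sub_le_of_near_image`);
* `sum_six_le_tailSix` — a finite sum of `|p_u − s_b|⁻⁶` over distinct points `s_b` of `Q`
  outside a translated block is at most `tailSix u`.

All `[folklore]`.
-/

noncomputable section

namespace Summit.AtomisticToContinuum.Crystallization.Theorems.ChargedPeriodicOptimal

open Literature.MathematicalPhysics.StatisticalMechanics
open Summit.AtomisticToContinuum.Crystallization.Theorems.ChargedEnergyGapNegative
open Summit.AtomisticToContinuum.Crystallization.Theorems.ChargedEnergyGapNegative.Blocks
open scoped BigOperators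
open Metric

variable (Q : PeriodicConfiguration 3) (K : ℕ)

/-! ## The Lennard-Jones tail of a block point is controlled by the sixth-power tail -/

/-- `V_LJ(r) ≤ (1/12) δ⁻⁶ · r⁻⁶` for `r ≥ δ > 0` (drop the attractive part and use
`r⁻¹² = r⁻⁶ · r⁻⁶ ≤ δ⁻⁶ r⁻⁶`). [folklore] -/
theorem lennardJones_le_six {δ r : ℝ} (hδ : 0 < δ) (hr : δ ≤ r) :
    lennardJones r ≤ 1 / 12 * δ⁻¹ ^ 6 * six r := by
  unfold lennardJones six
  have h0 : 0 ≤ r⁻¹ := inv_nonneg.2 (hδ.le.trans hr)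
  have h1 : r⁻¹ ≤ δ⁻¹ := inv_anti₀ hδ hr
  have h6 : r⁻¹ ^ 6 ≤ δ⁻¹ ^ 6 := pow_le_pow_left₀ h0 h1 6
  have h12 : r⁻¹ ^ 12 = r⁻¹ ^ 6 * r⁻¹ ^ 6 := by ring
  rw [h12]
  nlinarith [pow_nonneg h0 6, mul_le_mul_of_nonneg_right h6 (pow_nonneg h0 6)]

/-- **The tail is at most `(1/12)δ_Q⁻⁶ ·` the sixth-power tail**, where `δ_Q > 0` separates the
points of `Q`. [folklore] -/
theorem tail_le_tailSix {δ : ℝ} (hδ : 0 < δ)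
    (hsep : ∀ s ∈ Q.points, ∀ s' ∈ Q.points, s ≠ s' → δ ≤ dist s s') (u : BIdx Q K) :
    tail Q K lennardJones u ≤ 1 / 12 * δ⁻¹ ^ 6 * tailSix Q K u := by
  unfold tail tailSix
  rw [← tsum_mul_left]
  refine Summable.tsum_le_tsum (fun q => lennardJones_le_six hδ ?_) ?_ ?_
  · exact hsep _ (bpt_mem Q K u) _ q.1.2.1 (Ne.symm q.1.2.2)
  · exact (Q.summable_lennardJones_dist_three (bpt Q K u)).subtype _
  · exact ((summable_six Q (bpt Q K u)).subtype _).mul_left (1 / 12 * δ⁻¹ ^ 6)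

/-- **Lower bound on the block energy**:
`K³ · 2#F · e(Q) − (1/12) δ_Q⁻⁶ Σ_u tailSix u ≤ 2·E(block_K)`. [folklore] -/
theorem two_mul_energy_block_ge {δ : ℝ} (hδ : 0 < δ)
    (hsep : ∀ s ∈ Q.points, ∀ s' ∈ Q.points, s ≠ s' → δ ≤ dist s s') :
    (K : ℝ) ^ 3 * (2 * Q.motif.card * Q.energyPerParticle lennardJones) -
        1 / 12 * δ⁻¹ ^ 6 * ∑ u : BIdx Q K, tailSix Q K u ≤
      2 * interactionEnergy lennardJones (blockConfig Q K) := by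
  rw [two_mul_energy_block_eq, Finset.mul_sum]
  have : ∑ u : BIdx Q K, tail Q K lennardJones u ≤
      ∑ u : BIdx Q K, 1 / 12 * δ⁻¹ ^ 6 * tailSix Q K u :=
    Finset.sum_le_sum fun u _ => tail_le_tailSix Q K hδ hsep u
  linarith

/-! ## Size of a block -/

/-- **Blocks are bounded**: there is `R₀ ≥ 0` with `dist (bpt u) y' ≤ R₀` for every block index
`u` and every motif point `y'`. [folklore] -/
theorem exists_block_radius :
    ∃ R₀ : ℝ, 0 ≤ R₀ ∧ ∀ (u : BIdx Q K), ∀ y' ∈ Q.motif, dist (bpt Q K u) y' ≤ R₀ := by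
  refine ⟨∑ u : BIdx Q K, ∑ y' ∈ Q.motif, dist (bpt Q K u) y',
    Finset.sum_nonneg fun _ _ => Finset.sum_nonneg fun _ _ => dist_nonneg, fun u y' hy' => ?_⟩
  calc dist (bpt Q K u) y' ≤ ∑ y'' ∈ Q.motif, dist (bpt Q K u) y'' :=
        Finset.single_le_sum (f := fun y'' => dist (bpt Q K u) y'') (fun _ _ => dist_nonneg) hy'
    _ ≤ ∑ u' : BIdx Q K, ∑ y'' ∈ Q.motif, dist (bpt Q K u') y'' :=
        Finset.single_le_sum (f := fun u' => ∑ y'' ∈ Q.motif, dist (bpt Q K u') y'')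
          (fun _ _ => Finset.sum_nonneg fun _ _ => dist_nonneg) (Finset.mem_univ u)

/-! ## Continuity of the energy at the block configuration -/

/-- **Energy modulus at the block.** For every `η > 0` there is `ε₀ > 0` such that every
configuration `z` indexed by the block with `dist (z u) (bpt u) ≤ ε₀` for all `u` has
Lennard-Jones energy within `η` of the block's energy (the energy is continuous at the
injective block configuration: `V_LJ` is continuous on `(0, ∞)`). [folklore] -/
theorem exists_energy_modulus_block {η : ℝ} (hη : 0 < η) :
    ∃ ε₀ : ℝ, 0 < ε₀ ∧ ∀ z : BIdx Q K → E3, (∀ u, dist (z u) (bpt Q K u) ≤ ε₀) →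
      |interactionEnergy lennardJones (z ∘ (Fintype.equivFin (BIdx Q K)).symm) -
          interactionEnergy lennardJones (blockConfig Q K)| ≤ η := by
  classical
  -- a separation constant of `Q`
  obtain ⟨δ, hδ, hsep⟩ := Q.exists_pos_le_dist
  set n := Fintype.card (BIdx Q K) with hn
  set e := (Fintype.equivFin (BIdx Q K)).symm with he
  set w₀ : Fin n → E3 := blockConfig Q K with hw₀
  -- the energy is continuous on `δ/2`-separated configurations, a neighbourhood of `w₀`
  have hcont := continuousOn_interactionEnergy_lennardJones (d := 3) (N := n) (half_pos hδ)
  have hw₀sep : ∀ i k : Fin n, i ≠ k → δ ≤ dist (w₀ i) (w₀ k) := fun i k hik =>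
    hsep _ (bpt_mem Q K _) _ (bpt_mem Q K _) ((blockConfig_injective Q K).ne hik)
  have hnhds : {w : Fin n → E3 | ∀ i k, i ≠ k → δ / 2 ≤ dist (w i) (w k)} ∈ nhds w₀ := by
    refine Metric.mem_nhds_iff.2 ⟨δ / 4, by positivity, fun w hw i k hik => ?_⟩
    rw [Metric.mem_ball] at hw
    have hi : dist (w i) (w₀ i) < δ / 4 := (dist_le_pi_dist w w₀ i).trans_lt hw
    have hk : dist (w k) (w₀ k) < δ / 4 := (dist_le_pi_dist w w₀ k).trans_lt hw
    have h0 := hw₀sep i k hik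
    have h1 := dist_triangle4 (w₀ i) (w i) (w k) (w₀ k)
    rw [dist_comm (w₀ i) (w i)] at h1
    linarith
  have hat : ContinuousAt (fun w : Fin n → E3 => interactionEnergy lennardJones w) w₀ :=
    hcont.continuousAt hnhds
  obtain ⟨ε₁, hε₁, hball⟩ := Metric.continuousAt_iff.1 hat η hη
  refine ⟨ε₁ / 2, half_pos hε₁, fun z hz => ?_⟩
  have hdist : dist (z ∘ e) w₀ < ε₁ := by
    refine (dist_pi_le_iff (half_pos hε₁).le).2 (fun i => ?_) |>.trans_lt (half_lt_self hε₁)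
    simp only [Function.comp_apply, hw₀, blockConfig_apply]
    exact hz (e i)
  have := hball hdist
  rw [Real.dist_eq] at this
  exact this.le

/-- **Transfer to isometric images.** If `|E(z') − E(block)| ≤ η` whenever `z'` is `ε₀`-close to
the block, then the same holds for every `z` that is `ε₀`-close to the image of the block under
`v ↦ c + A (v + g − q)` with `A` a linear isometry of `ℝ³` (pull `z` back by the inverse rigid
motion; the energy is isometry invariant). [folklore] -/
theorem abs_energy_sub_le_of_near_image {η ε₀ : ℝ}
    (hmod : ∀ z : BIdx Q K → E3, (∀ u, dist (z u) (bpt Q K u) ≤ ε₀) →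
      |interactionEnergy lennardJones (z ∘ (Fintype.equivFin (BIdx Q K)).symm) -
          interactionEnergy lennardJones (blockConfig Q K)| ≤ η)
    (A : E3 →ₗᵢ[ℝ] E3) (c g q : E3) (z : BIdx Q K → E3)
    (hz : ∀ u, dist (z u) (c + A (bpt Q K u + g - q)) ≤ ε₀) :
    |interactionEnergy lennardJones (z ∘ (Fintype.equivFin (BIdx Q K)).symm) -
        interactionEnergy lennardJones (blockConfig Q K)| ≤ η := by
  set Ae : E3 ≃ₗᵢ[ℝ] E3 := A.toLinearIsometryEquiv rfl with hAe
  have hAe_apply : ∀ v, Ae v = A v := fun v => rfl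
  -- the inverse rigid motion
  set ψ : E3 → E3 := fun p => Ae.symm (p - c) - g + q with hψ
  have hψiso : Isometry ψ := by
    intro p p'
    simp only [hψ, edist_sub_right, edist_add_right]
    rw [Ae.symm.isometry (p - c) (p' - c), edist_sub_right]
  have hE : interactionEnergy lennardJones ((ψ ∘ z) ∘ (Fintype.equivFin (BIdx Q K)).symm) =
      interactionEnergy lennardJones (z ∘ (Fintype.equivFin (BIdx Q K)).symm) :=
    interactionEnergy_comp_isometry lennardJones hψiso _
  rw [← hE]
  refine hmod (ψ ∘ z) fun u => ?_
  have h1 : ψ (c + A (bpt Q K u + g - q)) = bpt Q K u := by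
    simp only [hψ]
    rw [add_sub_cancel_left, ← hAe_apply, Ae.symm_apply_apply]
    abel
  calc dist ((ψ ∘ z) u) (bpt Q K u) = dist (ψ (z u)) (ψ (c + A (bpt Q K u + g - q))) := by
        rw [h1]; rfl
    _ = dist (z u) (c + A (bpt Q K u + g - q)) := hψiso.dist_eq _ _
    _ ≤ ε₀ := hz u

/-! ## Finite sixth-power sums over outside points are bounded by the tail -/

/-- **Outside points cost at most the tail.** Let `g` be a period and `s : ι → ℝ³` map a finite
set `B` injectively to points of `Q` none of which is a point `bpt v + g` of the translated
block. Then `Σ_{b ∈ B} |bpt u + g − s_b|⁻⁶ ≤ tailSix u`. [folklore] -/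
theorem sum_six_le_tailSix (u : BIdx Q K) {ι : Type*} (B : Finset ι) (s : ι → E3) {g : E3}
    (hg : g ∈ Q.lattice) (hs : ∀ b ∈ B, s b ∈ Q.points)
    (hnot : ∀ b ∈ B, ∀ v : BIdx Q K, s b ≠ bpt Q K v + g) (hinj : Set.InjOn s B) :
    ∑ b ∈ B, six (dist (bpt Q K u + g) (s b)) ≤ tailSix Q K u := by
  classical
  -- notation: the "other points" type at `bpt u` and the complement of the block in it
  set p₀ : E3 := bpt Q K u with hp₀
  set C : Set {q : E3 // q ∈ Q.points ∧ q ≠ p₀} :=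
    ((blockOthers Q K u : Set {q : E3 // q ∈ Q.points ∧ q ≠ p₀})ᶜ : Set _) with hC
  set F : {q : E3 // q ∈ Q.points ∧ q ≠ p₀} → ℝ := fun q => six (dist p₀ q.1) with hF
  have htail : tailSix Q K u = ∑' q : {q : E3 // q ∈ Q.points ∧ q ≠ p₀}, C.indicator F q := by
    unfold tailSix
    rw [← tsum_subtype C F]
  -- the outside points `s b - g` as elements of that type
  have hmem : ∀ b ∈ B, s b - g ∈ Q.points ∧ s b - g ≠ p₀ := fun b hb =>
    ⟨by simpa [sub_eq_add_neg] using Q.add_mem_points (hs b hb) (Q.lattice.neg_mem hg),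
      fun h => hnot b hb u (by rw [hp₀] at h; rw [← h]; abel)⟩
  set emb : B → {q : E3 // q ∈ Q.points ∧ q ≠ p₀} := fun b => ⟨s b.1 - g, hmem b.1 b.2⟩
    with hemb
  have hemb_inj : Function.Injective emb := by
    intro b b' h
    have h' : s b.1 - g = s b'.1 - g := congrArg Subtype.val h
    exact Subtype.ext (hinj b.2 b'.2 (sub_left_injective h'))
  have hembC : ∀ b : B, emb b ∈ C := by
    intro b hbo
    have hbo' : emb b ∈ blockOthers Q K u := by simpa [hC] using hbo
    unfold blockOthers at hbo'
    obtain ⟨v, -, hv⟩ := Finset.mem_image.1 hbo'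
    have hval : bpt Q K v.1 = s b.1 - g := congrArg Subtype.val hv
    exact hnot b.1 b.2 v.1 (by rw [hval]; abel)
  set S' : Finset {q : E3 // q ∈ Q.points ∧ q ≠ p₀} := Finset.univ.image emb with hS'
  have hS'C : ∀ q ∈ S', q ∈ C := by
    intro q hq
    obtain ⟨b, -, rfl⟩ := Finset.mem_image.1 hq
    exact hembC b
  -- rewrite the finite sum as a sum over `S'` of the indicator
  have hlhs : ∑ b ∈ B, six (dist (bpt Q K u + g) (s b)) = ∑ q ∈ S', C.indicator F q := by
    rw [hS', Finset.sum_image fun b _ b' _ h => hemb_inj h, ← Finset.sum_coe_sort B]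
    refine Finset.sum_congr rfl fun b _ => ?_
    rw [Set.indicator_of_mem (hembC b), hF, hemb]
    simp only [hp₀]
    rw [dist_eq_norm, dist_eq_norm]
    congr 1
    abel
  rw [hlhs, htail]
  have hsumm : Summable (C.indicator F) := (summable_six Q p₀).indicator C
  exact hsumm.sum_le_tsum S' fun q _ => Set.indicator_nonneg (fun _ _ => six_nonneg _) q

end Summit.AtomisticToContinuum.Crystallization.Theorems.ChargedPeriodicOptimal

end
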